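import Summits.Ventures.PercRepro.CoreFourCounts
import Summits.Ventures.PercRepro.RankLevelSetCocircuitCount

/-!
# PercRepro — the counts of the corank-`5` core cells (p2, gen 12)

The corank-`4` counts of `CoreFourCounts`, re-done for corank `5` (`n = |E| = p + 5`): the rank-`3` side of a
`U`-partition now has `3`, `4` or `5` elements, and the sets of rank `≤ 3` with `≥ 5` points are controlled by PLANES:

* `topCount_le_five` — `#U(p,3) ≤ C(n,3) + #{4-sets of rank ≤ 3} + #{sets of rank ≤ 3 with ≥ 5 points}`;
* `ncard_eRk_le_three_le_general` — `#{r ≤ 3} ≤ Σ_{j≤3} C(n,j) + #{4-sets of rank ≤ 3} + #{sets of rank ≤ 3 with ≥ 5 points}`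
  (any corank);
* `ncard_isCircuit_four_le_of_nullity_le_four'`, `…_of_subset_nullity_le_four'` — `s₄ ≤ 35` at nullity `≤ 4` on `≤ 20` elements;
* `ncard_subsets_five_le_le`, `closure_eq_of_big_planes` — a set with `≤ 7` points has `≤ 29` subsets with `≥ 5` points
  (`≤ 1` if it has `≤ 5` points); two planes with `≥ 6` points coincide on the coloop-free core of nullity `≤ 5` and rank
  `≥ 7` (they meet in `≤ 3` points, so their union has nullity `≥ 5`, so it is `E`, of rank `≤ 6`);
* **`ncard_big_sets_le`** — `#{sets of rank ≤ 3 with ≥ 5 points} ≤ s₄ + 29`: every such set lies in the closure of a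
  `4`-circuit inside it (`exists_isCircuit_four_of_five`), a plane with `≤ 7` points (C2); the planes so obtained are at
  most `s₄` in number and at most one of them has `≥ 6` points.
Imports `CoreFourCounts`, `RankLevelSetCocircuitCount`. Axioms: standard.
-/

namespace PercRepro
namespace CoreFour

open Set Finset

variable {α : Type} {M : Matroid α}

/-! ### The two sides at corank `5` -/

/-- **`#U(p,3)` at corank `5`**: the rank-`3` side `B = E ∖ A` of a `U`-partition is coindependent, hence has `3`, `4`
or `5` elements. -/
theorem topCount_le_five [M.Finite] {p : ℕ} (hd : M.E.encard = M.eRank + 5) (hR : M.eRank = (p : ℕ∞)) :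
    Matroid.topCount M p 3 ≤ M.E.ncard.choose 3 + {B : Set α | B ⊆ M.E ∧ B.ncard = 4 ∧ M.eRk B ≤ 3}.ncard +
      {B : Set α | B ⊆ M.E ∧ M.eRk B ≤ 3 ∧ 5 ≤ B.ncard}.ncard := by
  classical
  have hE : (M.ground_finite.toFinset : Set α) = M.E := Set.Finite.coe_toFinset _
  have hinj : Set.InjOn (fun A : Set α => M.E \ A)
      {A : Set α | A ⊆ M.E ∧ M.eRk A = (p : ℕ∞) ∧ M.eRk (M.E \ A) = ((3 : ℕ) : ℕ∞)} := by
    intro X hX Y hY hXY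
    simp only at hXY
    rw [← Set.sdiff_sdiff_cancel_left hX.1, hXY, Set.sdiff_sdiff_cancel_left hY.1]
  have hmaps : ∀ A ∈ {A : Set α | A ⊆ M.E ∧ M.eRk A = (p : ℕ∞) ∧ M.eRk (M.E \ A) = ((3 : ℕ) : ℕ∞)},
      (fun A : Set α => M.E \ A) A ∈
        ({B : Set α | B ⊆ (M.ground_finite.toFinset : Set α) ∧ B.ncard = 3} ∪
          {B : Set α | B ⊆ M.E ∧ B.ncard = 4 ∧ M.eRk B ≤ 3}) ∪
          {B : Set α | B ⊆ M.E ∧ M.eRk B ≤ 3 ∧ 5 ≤ B.ncard} := by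
    rintro A ⟨hAE, hAr, hBr⟩
    simp only
    have hBE : M.E \ A ⊆ M.E := Set.sdiff_subset
    have hBfin : (M.E \ A).Finite := M.ground_finite.subset hBE
    have h3 : ((3 : ℕ) : ℕ∞) ≤ (M.E \ A).encard := by rw [← hBr]; exact M.eRk_le_encard _
    have hAp : (p : ℕ∞) ≤ A.encard := by rw [← hAr]; exact M.eRk_le_encard A
    have hsum : A.encard + (M.E \ A).encard = M.E.encard := by
      rw [add_comm]; exact Set.encard_sdiff_add_encard_of_subset hAE
    have h5 : (M.E \ A).encard ≤ 5 := by
      have h : (p : ℕ∞) + (M.E \ A).encard ≤ (p : ℕ∞) + 5 := by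
        calc (p : ℕ∞) + (M.E \ A).encard ≤ A.encard + (M.E \ A).encard := by gcongr
          _ = M.E.encard := hsum
          _ = (p : ℕ∞) + 5 := by rw [hd, hR]
      exact (WithTop.add_le_add_iff_left (WithTop.natCast_ne_top p)).1 h
    rw [← hBfin.cast_ncard_eq] at h3 h5
    have h3' : 3 ≤ (M.E \ A).ncard := by exact_mod_cast h3
    have h5' : (M.E \ A).ncard ≤ 5 := by exact_mod_cast h5
    have hBr3 : M.eRk (M.E \ A) ≤ 3 := by rw [hBr]; exact_mod_cast le_refl (3 : ℕ)
    rcases Nat.lt_or_ge (M.E \ A).ncard 4 with hlt | hge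
    · exact Or.inl (Or.inl ⟨by rw [hE]; exact hBE, by omega⟩)
    rcases Nat.lt_or_ge (M.E \ A).ncard 5 with hlt5 | hge5
    · exact Or.inl (Or.inr ⟨hBE, by omega, hBr3⟩)
    · exact Or.inr ⟨hBE, hBr3, hge5⟩
  have hfin : (({B : Set α | B ⊆ (M.ground_finite.toFinset : Set α) ∧ B.ncard = 3} ∪
        {B : Set α | B ⊆ M.E ∧ B.ncard = 4 ∧ M.eRk B ≤ 3}) ∪
        {B : Set α | B ⊆ M.E ∧ M.eRk B ≤ 3 ∧ 5 ≤ B.ncard}).Finite :=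
    (((M.ground_finite.toFinset.finite_toSet.finite_subsets).subset (fun X hX => hX.1)).union
      (M.ground_finite.finite_subsets.subset (fun X hX => hX.1))).union
      (M.ground_finite.finite_subsets.subset (fun X hX => hX.1))
  have hcard : M.ground_finite.toFinset.card = M.E.ncard := (Set.ncard_eq_toFinset_card _ _).symm
  calc Matroid.topCount M p 3
      = {A : Set α | A ⊆ M.E ∧ M.eRk A = (p : ℕ∞) ∧ M.eRk (M.E \ A) = ((3 : ℕ) : ℕ∞)}.ncard := rfl
    _ ≤ _ := Set.ncard_le_ncard_of_injOn _ hmaps hinj hfin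
    _ ≤ ({B : Set α | B ⊆ (M.ground_finite.toFinset : Set α) ∧ B.ncard = 3}.ncard +
          {B : Set α | B ⊆ M.E ∧ B.ncard = 4 ∧ M.eRk B ≤ 3}.ncard) +
          {B : Set α | B ⊆ M.E ∧ M.eRk B ≤ 3 ∧ 5 ≤ B.ncard}.ncard := by
        refine (Set.ncard_union_le _ _).trans ?_
        gcongr
        exact Set.ncard_union_le _ _
    _ = _ := by rw [ncard_subsets_ncard_eq, hcard]

/-- **The sets of rank `≤ 3`, any corank**: `≤ 3` points, `4` points, or `≥ 5` points. -/
theorem ncard_eRk_le_three_le_general [M.Finite] :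
    {X : Set α | X ⊆ M.E ∧ M.eRk X ≤ 3}.ncard ≤
      (∑ j ∈ Finset.range 4, M.E.ncard.choose j) + {X : Set α | X ⊆ M.E ∧ X.ncard = 4 ∧ M.eRk X ≤ 3}.ncard +
      {X : Set α | X ⊆ M.E ∧ M.eRk X ≤ 3 ∧ 5 ≤ X.ncard}.ncard := by
  classical
  have hE : (M.ground_finite.toFinset : Set α) = M.E := Set.Finite.coe_toFinset _
  have hcard : M.ground_finite.toFinset.card = M.E.ncard := (Set.ncard_eq_toFinset_card _ _).symm
  have hcover : {X : Set α | X ⊆ M.E ∧ M.eRk X ≤ 3} ⊆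
      ({X : Set α | X ⊆ (M.ground_finite.toFinset : Set α) ∧ X.ncard ≤ 3} ∪
        {X : Set α | X ⊆ M.E ∧ X.ncard = 4 ∧ M.eRk X ≤ 3}) ∪
        {X : Set α | X ⊆ M.E ∧ M.eRk X ≤ 3 ∧ 5 ≤ X.ncard} := by
    rintro X ⟨hXE, hXr⟩
    rcases Nat.lt_or_ge X.ncard 4 with h3 | h4
    · exact Or.inl (Or.inl ⟨by rw [hE]; exact hXE, by omega⟩)
    rcases Nat.lt_or_ge X.ncard 5 with h4' | h5
    · exact Or.inl (Or.inr ⟨hXE, by omega, hXr⟩)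
    · exact Or.inr ⟨hXE, hXr, h5⟩
  have hfinE := M.ground_finite.finite_subsets
  have hfin : (({X : Set α | X ⊆ (M.ground_finite.toFinset : Set α) ∧ X.ncard ≤ 3} ∪
        {X : Set α | X ⊆ M.E ∧ X.ncard = 4 ∧ M.eRk X ≤ 3}) ∪
        {X : Set α | X ⊆ M.E ∧ M.eRk X ≤ 3 ∧ 5 ≤ X.ncard}).Finite := by
    refine ((hfinE.subset ?_).union (hfinE.subset ?_)).union (hfinE.subset ?_)
    · intro X hX; rw [hE] at hX; exact hX.1
    · intro X hX; exact hX.1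
    · intro X hX; exact hX.1
  have h3 := ncard_subsets_ncard_le (M.ground_finite.toFinset) 3
  rw [hcard] at h3
  calc {X : Set α | X ⊆ M.E ∧ M.eRk X ≤ 3}.ncard
      ≤ _ := Set.ncard_le_ncard hcover hfin
    _ ≤ ({X : Set α | X ⊆ (M.ground_finite.toFinset : Set α) ∧ X.ncard ≤ 3}.ncard +
          {X : Set α | X ⊆ M.E ∧ X.ncard = 4 ∧ M.eRk X ≤ 3}.ncard) +
          {X : Set α | X ⊆ M.E ∧ M.eRk X ≤ 3 ∧ 5 ≤ X.ncard}.ncard := by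
        refine (Set.ncard_union_le _ _).trans ?_
        gcongr
        exact Set.ncard_union_le _ _
    _ ≤ _ := by gcongr

/-! ### `s₄ ≤ 35` at nullity `≤ 4` on `≤ 20` elements -/

/-- Four-element circuits at nullity `≤ 4` on at most `20` elements: at most `35` (the maximum `C(7,3)` at `c = 7`). -/
theorem ncard_isCircuit_four_le_of_nullity_le_four' (M : Matroid α) [M.Finite]
    (hE : M.E.ncard ≤ 20) (hν : M✶.eRank ≤ 4) :
    {C | M.IsCircuit C ∧ C.ncard = 4}.ncard ≤ 35 := by
  obtain ⟨ν, hν4, hν'⟩ := PercRepro.Matroid.exists_nullity_eq_of_le M (n := 4) (by exact_mod_cast hν)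
  obtain ⟨c, hc, h⟩ := PercRepro.Matroid.exists_ncard_isCircuit_mul_choose_le M hν' 4
  have hc' : c ≤ 20 := hc.trans hE
  generalize {C | M.IsCircuit C ∧ C.ncard = 4}.ncard = s at h ⊢
  interval_cases ν <;> interval_cases c <;>
    norm_num [Nat.choose_eq_factorial_div_factorial, Nat.factorial, Nat.choose_two_right,
      Nat.choose_eq_zero_of_lt] at h ⊢ <;> omega

/-- The same for the `4`-circuits of `M` lying in a set `S` with `|S| ≤ 20` and `|S| ≤ r(S) + 4`. -/
theorem ncard_isCircuit_four_le_of_subset_nullity_le_four' (M : Matroid α) [M.Finite] {S : Set α}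
    (hS : S ⊆ M.E) (hcov : ∀ C, M.IsCircuit C → C.ncard = 4 → C ⊆ S) (hSc : S.ncard ≤ 20)
    (hν : S.encard ≤ M.eRk S + 4) : {C | M.IsCircuit C ∧ C.ncard = 4}.ncard ≤ 35 := by
  haveI : (M.restrict S).Finite := Matroid.restrict_finite (M.ground_finite.subset hS)
  rw [← PercRepro.Matroid.setOf_isCircuit_ncard_restrict_eq hS hcov]
  refine ncard_isCircuit_four_le_of_nullity_le_four' (M.restrict S) ?_
    (PercRepro.Matroid.dual_eRank_restrict_le hS hν)
  rwa [Matroid.restrict_ground_eq]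

/-! ### The sets of rank `≤ 3` with `≥ 5` points, by planes -/

/-- A set with `≤ 3` points of a simple matroid has nullity `≤ 1`. -/
theorem ncard_le_eRk_add_one_of_le_three [M.Finite] (hs : ∀ e ∈ M.E, ∀ f ∈ M.E, e ≠ f → M.eRk {e, f} = 2)
    {W : Set α} (hW : W ⊆ M.E) (h3 : W.ncard ≤ 3) : (W.ncard : ℕ∞) ≤ M.eRk W + 1 := by
  obtain ⟨r, hr⟩ := exists_eRk_eq_nat (M := M) W
  rw [hr]
  have key : W.ncard ≤ r + 1 := by
    rcases Nat.lt_or_ge W.ncard 2 with hlt | hge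
    · omega
    · have := two_le_eRk_of_two_le_ncard hs hW hge
      rw [hr] at this
      have : 2 ≤ r := by exact_mod_cast this
      omega
  exact_mod_cast key

/-- A finite set with `≤ 7` points has at most `29 = C(7,5) + C(7,6) + C(7,7)` subsets with `≥ 5` points. -/
theorem ncard_subsets_five_le_le {P : Set α} (hP : P.Finite) (h7 : P.ncard ≤ 7) :
    {X : Set α | X ⊆ P ∧ 5 ≤ X.ncard}.ncard ≤ 29 := by
  classical
  set F := hP.toFinset with hF
  have hPF : (F : Set α) = P := Set.Finite.coe_toFinset _
  have hFc : F.card = P.ncard := (Set.ncard_eq_toFinset_card _ _).symm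
  have hcover : {X : Set α | X ⊆ P ∧ 5 ≤ X.ncard} ⊆
      ({X : Set α | X ⊆ (F : Set α) ∧ X.ncard = 5} ∪ {X : Set α | X ⊆ (F : Set α) ∧ X.ncard = 6}) ∪
        {X : Set α | X ⊆ (F : Set α) ∧ X.ncard = 7} := by
    rintro X ⟨hXP, hX5⟩
    have hle : X.ncard ≤ P.ncard := Set.ncard_le_ncard hXP hP
    rw [← hPF] at hXP
    rcases (show X.ncard = 5 ∨ X.ncard = 6 ∨ X.ncard = 7 by omega) with h | h | h
    · exact Or.inl (Or.inl ⟨hXP, h⟩)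
    · exact Or.inl (Or.inr ⟨hXP, h⟩)
    · exact Or.inr ⟨hXP, h⟩
  have hfin : (({X : Set α | X ⊆ (F : Set α) ∧ X.ncard = 5} ∪ {X : Set α | X ⊆ (F : Set α) ∧ X.ncard = 6}) ∪
        {X : Set α | X ⊆ (F : Set α) ∧ X.ncard = 7}).Finite :=
    ((F.finite_toSet.finite_subsets.subset (fun X hX => hX.1)).union
      (F.finite_toSet.finite_subsets.subset (fun X hX => hX.1))).union
      (F.finite_toSet.finite_subsets.subset (fun X hX => hX.1))
  calc {X : Set α | X ⊆ P ∧ 5 ≤ X.ncard}.ncard ≤ _ := Set.ncard_le_ncard hcover hfin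
    _ ≤ ({X : Set α | X ⊆ (F : Set α) ∧ X.ncard = 5}.ncard + {X : Set α | X ⊆ (F : Set α) ∧ X.ncard = 6}.ncard) +
          {X : Set α | X ⊆ (F : Set α) ∧ X.ncard = 7}.ncard := by
        refine (Set.ncard_union_le _ _).trans ?_
        gcongr
        exact Set.ncard_union_le _ _
    _ = (F.card.choose 5 + F.card.choose 6) + F.card.choose 7 := by
        rw [ncard_subsets_ncard_eq, ncard_subsets_ncard_eq, ncard_subsets_ncard_eq]
    _ ≤ ((7 : ℕ).choose 5 + (7 : ℕ).choose 6) + (7 : ℕ).choose 7 := by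
        have h7' : F.card ≤ 7 := by rw [hFc]; exact h7
        gcongr
    _ = 29 := by norm_num [Nat.choose]

/-- A finite set with `≤ 5` points has at most one subset with `≥ 5` points (itself). -/
theorem ncard_subsets_five_le_le_one {P : Set α} (hP : P.Finite) (h5 : P.ncard ≤ 5) :
    {X : Set α | X ⊆ P ∧ 5 ≤ X.ncard}.ncard ≤ 1 := by
  have hsub : {X : Set α | X ⊆ P ∧ 5 ≤ X.ncard} ⊆ {P} := by
    rintro X ⟨hXP, hX5⟩
    rw [Set.mem_singleton_iff]
    exact Set.eq_of_subset_of_ncard_le hXP (by omega) hP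
  calc {X : Set α | X ⊆ P ∧ 5 ≤ X.ncard}.ncard ≤ ({P} : Set (Set α)).ncard :=
        Set.ncard_le_ncard hsub (Set.finite_singleton P)
    _ = 1 := Set.ncard_singleton P

/-- **Two planes with `≥ 6` points coincide** on the coloop-free core of nullity `≤ 5` and rank `≥ 7`: they meet in a
set of rank `≤ 2`, hence of `≤ 3` points and nullity `≤ 1`, so their union has nullity `≥ 3 + 3 − 1 = 5`, is `E`, and
`r(E) ≤ 6`. -/
theorem closure_eq_of_big_planes [M.Finite] (hs : ∀ e ∈ M.E, ∀ f ∈ M.E, e ≠ f → M.eRk {e, f} = 2)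
    (hC1 : ∀ L ⊆ M.E, M.eRk L = 2 → L.ncard ≤ 3) (hcoloop : ∀ e, ¬ M.IsColoop e)
    {d : ℕ} (hd : M.E.encard = M.eRank + d) (hd5 : d ≤ 5) {p : ℕ} (hrank : M.eRank = (p : ℕ∞)) (hp : 7 ≤ p)
    {P Q : Set α} (hPE : P ⊆ M.E) (hQE : Q ⊆ M.E) (hPr : M.eRk P = 3) (hQr : M.eRk Q = 3)
    (hPcl : M.closure P = P) (hQcl : M.closure Q = Q) (hP6 : 6 ≤ P.ncard) (hQ6 : 6 ≤ Q.ncard) : P = Q := by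
  by_contra hne
  have hPfin : P.Finite := M.ground_finite.subset hPE
  have hQfin : Q.Finite := M.ground_finite.subset hQE
  have hIfin : (P ∩ Q).Finite := hPfin.subset Set.inter_subset_left
  have hUfin : (P ∪ Q).Finite := hPfin.union hQfin
  obtain ⟨rI, hrI⟩ := exists_eRk_eq_nat (M := M) (P ∩ Q)
  obtain ⟨rU, hrU⟩ := exists_eRk_eq_nat (M := M) (P ∪ Q)
  -- the intersection has rank `≤ 2`
  have hrI2 : rI ≤ 2 := by
    by_contra h
    push Not at h
    have hle : M.eRk P ≤ M.eRk (P ∩ Q) := by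
      rw [hPr, hrI]; exact_mod_cast h
    have hle' : M.eRk Q ≤ M.eRk (P ∩ Q) := by
      rw [hQr, hrI]; exact_mod_cast h
    have h1 := (M.isRkFinite_of_finite hIfin).closure_eq_closure_of_subset_of_eRk_ge_eRk
      (Set.inter_subset_left : P ∩ Q ⊆ P) hle
    have h2 := (M.isRkFinite_of_finite hIfin).closure_eq_closure_of_subset_of_eRk_ge_eRk
      (Set.inter_subset_right : P ∩ Q ⊆ Q) hle'
    rw [hPcl] at h1
    rw [hQcl] at h2
    exact hne (h1.symm.trans h2)
  -- hence `≤ 3` points and nullity `≤ 1`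
  have hI3 : (P ∩ Q).ncard ≤ 3 := by
    by_contra h
    push Not at h
    have := three_le_eRk_of_four_le_ncard hs hC1 (Y := P ∩ Q) (Set.inter_subset_left.trans hPE) (by omega)
    rw [hrI] at this
    have : 3 ≤ rI := by exact_mod_cast this
    omega
  have hIν := ncard_le_eRk_add_one_of_le_three hs (Set.inter_subset_left.trans hPE) hI3
  rw [hrI] at hIν
  have e1 : (P ∩ Q).ncard ≤ rI + 1 := by exact_mod_cast hIν
  -- submodularity and inclusion–exclusion
  have hsub := M.eRk_inter_add_eRk_union_le P Q
  rw [hPr, hQr, hrI, hrU] at hsub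
  have e2 : rI + rU ≤ 3 + 3 := by exact_mod_cast hsub
  have e3 := Set.ncard_union_add_ncard_inter P Q hPfin hQfin
  -- nullity is monotone
  have hmono := encard_le_eRk_add_of_ground (Set.union_subset hPE hQE) hd
  rw [← hUfin.cast_ncard_eq, hrU] at hmono
  have e4 : (P ∪ Q).ncard ≤ rU + d := by exact_mod_cast hmono
  -- so the union has full nullity `d = 5`
  have hd5' : d = 5 := by omega
  have hfull : (P ∪ Q).encard = M.eRk (P ∪ Q) + d := by
    rw [← hUfin.cast_ncard_eq, hrU]
    have : (P ∪ Q).ncard = rU + d := by omega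
    rw [this]; push_cast; rfl
  have hUE := eq_ground_of_encard_eq_eRk_add hcoloop (Set.union_subset hPE hQE) hd hfull
  -- and `r(E) = r(P ∪ Q) ≤ 6 < 7 ≤ p`
  have hrE : M.eRank = (rU : ℕ∞) := by rw [← M.eRk_ground, ← hUE, hrU]
  rw [hrank] at hrE
  have : p = rU := by exact_mod_cast hrE
  omega

/-- **The sets of rank `≤ 3` with `≥ 5` points number at most `s₄ + 29`** on the coloop-free core of nullity `≤ 5`,
rank `≥ 7`, with (C2): every such set lies in the closure of a `4`-circuit inside it — a plane with `≤ 7` points;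
the planes so obtained are at most `s₄` in number, at most one of them has `≥ 6` points (`≤ 29` subsets with `≥ 5`
points), and the others have `≤ 5` points (`≤ 1` such subset). -/
theorem ncard_big_sets_le [M.Finite] (hs : ∀ e ∈ M.E, ∀ f ∈ M.E, e ≠ f → M.eRk {e, f} = 2)
    (hC1 : ∀ L ⊆ M.E, M.eRk L = 2 → L.ncard ≤ 3) (hC2 : ∀ P ⊆ M.E, M.eRk P = 3 → P.ncard ≤ 7)
    (hcoloop : ∀ e, ¬ M.IsColoop e) {d : ℕ} (hd : M.E.encard = M.eRank + d) (hd5 : d ≤ 5)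
    {p : ℕ} (hrank : M.eRank = (p : ℕ∞)) (hp : 7 ≤ p) :
    {X : Set α | X ⊆ M.E ∧ M.eRk X ≤ 3 ∧ 5 ≤ X.ncard}.ncard ≤ (PercRepro.Matroid.circuitsEq M 4).ncard + 29 := by
  classical
  have h4fin : (PercRepro.Matroid.circuitsEq M 4).Finite := PercRepro.Matroid.circuitsEq_finite 4
  set F₄ := h4fin.toFinset with hF₄
  set Pl := F₄.image (fun C => M.closure C) with hPldef
  have hEsub : {X : Set α | X ⊆ M.E}.Finite := M.ground_finite.finite_subsets
  let g : Set α → Finset (Set α) := fun P => hEsub.toFinset.filter (fun X => X ⊆ P ∧ 5 ≤ X.ncard)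
  -- the planes
  have hPl : ∀ P ∈ Pl, P ⊆ M.E ∧ M.eRk P = 3 ∧ M.closure P = P ∧ P.ncard ≤ 7 := by
    intro P hP
    rw [hPldef, Finset.mem_image] at hP
    obtain ⟨C, hC, rfl⟩ := hP
    rw [hF₄, Set.Finite.mem_toFinset] at hC
    have hCfin : C.Finite := M.ground_finite.subset hC.1.subset_ground
    have hCr : M.eRk C = 3 := by
      have h := hC.1.eRk_add_one_eq
      rw [← hCfin.cast_ncard_eq, hC.2] at h
      obtain ⟨r, hr⟩ := exists_eRk_eq_nat (M := M) C
      rw [hr] at h ⊢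
      have : r + 1 = 4 := by exact_mod_cast h
      have : r = 3 := by omega
      rw [this]; rfl
    have hclr : M.eRk (M.closure C) = 3 := by rw [M.eRk_closure_eq]; exact hCr
    exact ⟨M.closure_subset_ground C, hclr, M.closure_closure C, hC2 _ (M.closure_subset_ground C) hclr⟩
  -- every big set of rank `≤ 3` lies in some plane of `Pl`
  have hcover : {X : Set α | X ⊆ M.E ∧ M.eRk X ≤ 3 ∧ 5 ≤ X.ncard} ⊆ ↑(Pl.biUnion g) := by
    rintro X ⟨hXE, hXr, hX5⟩
    obtain ⟨Y, hYX, hY5⟩ := Set.exists_subset_card_eq hX5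
    have hYE : Y ⊆ M.E := hYX.trans hXE
    obtain ⟨C, hCY, hC, hC4⟩ := exists_isCircuit_four_of_five hs hC1 hYE hY5 ((M.eRk_mono hYX).trans hXr)
    have hCX : C ⊆ X := hCY.trans hYX
    have hCfin : C.Finite := M.ground_finite.subset hC.subset_ground
    have hCr : M.eRk C = 3 := by
      have h := hC.eRk_add_one_eq
      rw [← hCfin.cast_ncard_eq, hC4] at h
      obtain ⟨r, hr⟩ := exists_eRk_eq_nat (M := M) C
      rw [hr] at h ⊢
      have : r + 1 = 4 := by exact_mod_cast h
      have : r = 3 := by omega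
      rw [this]; rfl
    have hcl : M.closure C = M.closure X :=
      (M.isRkFinite_of_finite hCfin).closure_eq_closure_of_subset_of_eRk_ge_eRk hCX (by rw [hCr]; exact hXr)
    have hXcl : X ⊆ M.closure C := by rw [hcl]; exact M.subset_closure X hXE
    rw [Finset.mem_coe, Finset.mem_biUnion]
    refine ⟨M.closure C, ?_, ?_⟩
    · rw [hPldef, Finset.mem_image]
      exact ⟨C, by rw [hF₄, Set.Finite.mem_toFinset]; exact ⟨hC, hC4⟩, rfl⟩
    · simp only [g, Finset.mem_filter, Set.Finite.mem_toFinset, Set.mem_setOf_eq]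
      exact ⟨hXE, hXcl, hX5⟩
  -- the per-plane counts
  have hg : ∀ P ∈ Pl, (g P).card ≤ {X : Set α | X ⊆ P ∧ 5 ≤ X.ncard}.ncard := by
    intro P hP
    have hPE := (hPl P hP).1
    have hfinS : {X : Set α | X ⊆ P ∧ 5 ≤ X.ncard}.Finite := hEsub.subset (fun X hX => hX.1.trans hPE)
    have hsub : (↑(g P) : Set (Set α)) ⊆ {X : Set α | X ⊆ P ∧ 5 ≤ X.ncard} := by
      intro X hX
      simp only [g, Finset.coe_filter, Set.Finite.mem_toFinset, Set.mem_setOf_eq] at hX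
      exact ⟨hX.2.1, hX.2.2⟩
    have := Set.ncard_le_ncard hsub hfinS
    rwa [Set.ncard_coe_finset] at this
  have hbig : ∀ P ∈ Pl, (g P).card ≤ 29 := by
    intro P hP
    exact (hg P hP).trans (ncard_subsets_five_le_le (M.ground_finite.subset (hPl P hP).1) (hPl P hP).2.2.2)
  have hsmall : ∀ P ∈ Pl, P.ncard ≤ 5 → (g P).card ≤ 1 := by
    intro P hP h5
    exact (hg P hP).trans (ncard_subsets_five_le_le_one (M.ground_finite.subset (hPl P hP).1) h5)
  -- at most one plane with `≥ 6` points
  have hone : (Pl.filter (fun Q => 6 ≤ Q.ncard)).card ≤ 1 := by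
    rw [Finset.card_le_one]
    intro P hP Q hQ
    rw [Finset.mem_filter] at hP hQ
    obtain ⟨hPE, hPr, hPcl, _⟩ := hPl P hP.1
    obtain ⟨hQE, hQr, hQcl, _⟩ := hPl Q hQ.1
    exact closure_eq_of_big_planes hs hC1 hcoloop hd hd5 hrank hp hPE hQE hPr hQr hPcl hQcl hP.2 hQ.2
  -- assemble
  set big := Pl.filter (fun Q => 6 ≤ Q.ncard) with hbigdef
  set small := Pl.filter (fun Q => ¬ 6 ≤ Q.ncard) with hsmalldef
  have hsplit : (∑ P ∈ big, (g P).card) + ∑ P ∈ small, (g P).card = ∑ P ∈ Pl, (g P).card := by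
    rw [hbigdef, hsmalldef]
    exact Finset.sum_filter_add_sum_filter_not Pl (fun Q => 6 ≤ Q.ncard) (fun P => (g P).card)
  have hA : ∑ P ∈ big, (g P).card ≤ 29 := by
    calc ∑ P ∈ big, (g P).card ≤ ∑ _P ∈ big, 29 :=
          Finset.sum_le_sum (fun P hP => hbig P (Finset.mem_filter.1 hP).1)
      _ = big.card * 29 := by rw [Finset.sum_const, smul_eq_mul]
      _ ≤ 1 * 29 := Nat.mul_le_mul_right _ hone
      _ = 29 := by norm_num
  have hB : ∑ P ∈ small, (g P).card ≤ (PercRepro.Matroid.circuitsEq M 4).ncard := by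
    calc ∑ P ∈ small, (g P).card ≤ ∑ _P ∈ small, 1 :=
          Finset.sum_le_sum (fun P hP => hsmall P (Finset.mem_filter.1 hP).1 (by
            have := (Finset.mem_filter.1 hP).2; omega))
      _ = small.card := by rw [Finset.sum_const, smul_eq_mul, mul_one]
      _ ≤ Pl.card := Finset.card_filter_le _ _
      _ ≤ F₄.card := Finset.card_image_le
      _ = (PercRepro.Matroid.circuitsEq M 4).ncard := by rw [hF₄, ← Set.ncard_eq_toFinset_card _ h4fin]
  calc {X : Set α | X ⊆ M.E ∧ M.eRk X ≤ 3 ∧ 5 ≤ X.ncard}.ncard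
      ≤ (↑(Pl.biUnion g) : Set (Set α)).ncard := Set.ncard_le_ncard hcover (Finset.finite_toSet _)
    _ = (Pl.biUnion g).card := Set.ncard_coe_finset _
    _ ≤ ∑ P ∈ Pl, (g P).card := Finset.card_biUnion_le
    _ = (∑ P ∈ big, (g P).card) + ∑ P ∈ small, (g P).card := hsplit.symm
    _ ≤ 29 + (PercRepro.Matroid.circuitsEq M 4).ncard := Nat.add_le_add hA hB
    _ = _ := by ring

end CoreFour
end PercRepro
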